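import Summits.Ventures.CertifiedArithmetic.LowPrec.GemmThetaE2M1
import Summits.Ventures.CertifiedArithmetic.LowPrec.GemmTerminalE2M1

/-!
# `W(n)` of E2M1²→bfloat16 as a defined maximum, sandwiched for every `n ≥ 709`

HONEST FRAMING (venture CertifiedArithmetic / cell `pub-lowprec`, seat gemm, gen 6): certified error
envelopes and provably optimal rounding/accumulation schemes for low-precision formats under stated
cost models; every table by two implementations; no hardware or vendor claims.

Paper `gemm.tex` §Model defines the worst-case relative error `W(n)` of a configuration as the maximum
of `R = |ŝ - Σ x_i| / Σ|x_i|` over all inputs of `n` letters.  For E2M1·E2M1 products accumulated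
sequentially in `bfloat16` (RNE) this file makes `W(n)` a Lean term — `worstRelErrE2M1BF16 m`, the
`Finset.sup'` of `relErr` over the `37^(m+1)` words of length `n = m + 1` (`wordInput`) — proves
that every input of letters is dominated by it (`relErr_le_worst`), and assembles the two
kernel-checked bounds of the cell into one statement about `W(n)` itself:
* `worst_le`  : `W(n) ≤ 1 - 210/(8n + 2625)` for every `n` (Prop. Θ(i), `GemmThetaE2M1.lean`);
* `worst_ge`  : `(8n - 4737)/(8n - 4527) ≤ W(n)` for every `n ≥ 709` (the terminal family
  `TieChain.e2m1_709`, `GemmTerminalE2M1.lean`);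
so `1 - W(n)` lies between `210/(8n + 2625)` and `210/(8n - 4527)` for every `n ≥ 709`
(`worst_sandwich`) — two hyperbolas `894` apart in `n`; the paper's two-implementation certificate
says the upper one is exact from `n = 1525` on (Prop. "all n" (iii); not kernel-checked).
-/

namespace Literature.ComputerArithmetic.FloatingPoint

namespace MiniFloat

open Finset

/-- THE FUNCTIONAL `R`: relative error of the sequential sum of `x 0, …, x m` (junk `0` when all
terms vanish, by `x / 0 = 0`). [cell, gemm.tex §Model] -/
def relErr (α : Format) (x : ℕ → ℚ) (m : ℕ) : ℚ :=
  |(seqSum α x m).toRat - ∑ j ∈ range (m + 1), x j| / ∑ j ∈ range (m + 1), |x j|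

/-- `seqSum … m` depends only on the first `m + 1` terms. [folklore] -/
theorem seqSum_congr (α : Format) {x y : ℕ → ℚ} :
    ∀ m, (∀ j ≤ m, x j = y j) → seqSum α x m = seqSum α y m
  | 0, h => by simp [seqSum, h 0 le_rfl]
  | m + 1, h => by
      simp only [seqSum]
      rw [seqSum_congr α m (fun j hj => h j (by omega)), h (m + 1) le_rfl]

/-- `relErr … m` depends only on the first `m + 1` terms. [folklore] -/
theorem relErr_congr (α : Format) {x y : ℕ → ℚ} {m : ℕ} (h : ∀ j ≤ m, x j = y j) :
    relErr α x m = relErr α y m := by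
  unfold relErr
  have h' : ∀ j ∈ range (m + 1), x j = y j := fun j hj => h j (by have := mem_range.mp hj; omega)
  have e1 : ∑ j ∈ range (m + 1), x j = ∑ j ∈ range (m + 1), y j := sum_congr rfl h'
  have e2 : ∑ j ∈ range (m + 1), |x j| = ∑ j ∈ range (m + 1), |y j| :=
    sum_congr rfl (fun j hj => by rw [h' j hj])
  rw [seqSum_congr α m h, e1, e2]

/-- `piE2M1` has `37` letters. [cell] -/
theorem piE2M1_length : piE2M1.length = 37 := by decide

/-- THE INPUT SPELLED BY A WORD `w : Fin (m+1) → Fin 37` (letters of `piE2M1` by index; `0` after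
position `m`). [cell, gemm.tex §Model] -/
def wordInput {m : ℕ} (w : Fin (m + 1) → Fin 37) : ℕ → ℚ :=
  fun j => if h : j < m + 1 then piE2M1[(w ⟨j, h⟩).val]'(by rw [piE2M1_length]; exact (w _).isLt) else 0

/-- Every term of a word input is a letter. [cell] -/
theorem wordInput_mem {m : ℕ} (w : Fin (m + 1) → Fin 37) (j : ℕ) : wordInput w j ∈ piE2M1 := by
  unfold wordInput
  split_ifs
  · exact List.getElem_mem _
  · decide

/-- `W(n)` OF E2M1²→bfloat16 (sequential, RNE, exact products), `n = m + 1`: the maximum of the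
relative error over all `37^(m+1)` inputs of letters. [cell, gemm.tex §Model] -/
def worstRelErrE2M1BF16 (m : ℕ) : ℚ :=
  (univ : Finset (Fin (m + 1) → Fin 37)).sup' univ_nonempty
    (fun w => relErr Format.BFloat16 (wordInput w) m)

/-- Every input of letters is dominated by `W(n)`. [cell, gemm.tex §Model] -/
theorem relErr_le_worst (x : ℕ → ℚ) (hx : ∀ j, x j ∈ piE2M1) (m : ℕ) :
    relErr Format.BFloat16 x m ≤ worstRelErrE2M1BF16 m := by
  classical
  have hidx : ∀ j, ∃ i : Fin 37, ∀ h : i.val < piE2M1.length, piE2M1[i.val]'h = x j := by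
    intro j
    obtain ⟨i, hi, h⟩ := List.getElem_of_mem (hx j)
    exact ⟨⟨i, by simpa [piE2M1_length] using hi⟩, fun _ => h⟩
  choose f hf using hidx
  have hxy : ∀ j ≤ m, x j = wordInput (fun j : Fin (m + 1) => f j.val) j := by
    intro j hj
    unfold wordInput
    rw [dif_pos (by omega)]
    exact (hf j _).symm
  rw [relErr_congr Format.BFloat16 hxy]
  exact le_sup' (fun w => relErr Format.BFloat16 (wordInput w) m) (mem_univ _)

/-- UPPER BOUND FOR EVERY `n` (Prop. Θ(i), kernel-checked): `W(n) ≤ 1 - 210/(8n + 2625)`.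
[cell, gemm.tex §Regimes Prop. Θ(i)] -/
theorem worst_le (m : ℕ) : worstRelErrE2M1BF16 m ≤ 1 - 210 / (8 * (m + 1) + 2625) := by
  apply sup'_le
  intro w _
  unfold relErr
  have hc : (0 : ℚ) ≤ 1 - 210 / (8 * (m + 1) + 2625) := by
    rw [sub_nonneg, div_le_one (by positivity)]; linarith [show (0 : ℚ) ≤ m from Nat.cast_nonneg m]
  by_cases hL : ∑ j ∈ range (m + 1), |wordInput w j| = 0
  · rw [hL, div_zero]; exact hc
  · have hpos : 0 < ∑ j ∈ range (m + 1), |wordInput w j| :=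
      lt_of_le_of_ne (sum_nonneg fun i _ => abs_nonneg _) (Ne.symm hL)
    rw [div_le_iff₀ hpos]
    exact abs_err_le_E2M1_BFloat16 _ (wordInput_mem w) m

/-- LOWER BOUND FOR EVERY `n ≥ 709` (the terminal family, kernel-checked):
`(8n - 4737)/(8n - 4527) ≤ W(n)`. [cell, gemm.tex §Regimes Prop. "all n" (iii)] -/
theorem worst_ge (m : ℕ) (hm : 708 ≤ m) :
    (8 * ((m : ℚ) + 1) - 4737) / (8 * (m + 1) - 4527) ≤ worstRelErrE2M1BF16 m := by
  have h := TieChain.e2m1_709_ratio (m + 1) (by omega)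
  rw [Nat.add_sub_cancel] at h
  have hw := relErr_le_worst TieChain.e2m1_709 TieChain.e2m1_709_mem m
  unfold relErr at hw
  rw [h] at hw
  push_cast at hw
  exact hw

/-- THE SANDWICH FOR EVERY `n ≥ 709`, both sides kernel-checked:
`210/(8n + 2625) ≤ 1 - W(n) ≤ 210/(8n - 4527)`. [cell, gemm.tex §Regimes] -/
theorem worst_sandwich (m : ℕ) (hm : 708 ≤ m) :
    210 / (8 * ((m : ℚ) + 1) + 2625) ≤ 1 - worstRelErrE2M1BF16 m ∧
      1 - worstRelErrE2M1BF16 m ≤ 210 / (8 * ((m : ℚ) + 1) - 4527) := by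
  refine ⟨by linarith [worst_le m], ?_⟩
  have h := worst_ge m hm
  have hm' : (708 : ℚ) ≤ m := by exact_mod_cast hm
  have hden : (0 : ℚ) < 8 * ((m : ℚ) + 1) - 4527 := by linarith
  have e : (8 * ((m : ℚ) + 1) - 4737) / (8 * (m + 1) - 4527) = 1 - 210 / (8 * ((m : ℚ) + 1) - 4527) := by
    field_simp; ring
  linarith [e]

end MiniFloat

end Literature.ComputerArithmetic.FloatingPoint
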